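import Summits.BirchSwinnertonDyer.BirchSwinnertonDyer.Theorems.CMKolyvaginAtInertTwoRestrictionInjectiveAtTwo
import HarnessLib

/-!
# Route `CMKolyvaginAtInertTwo`, crux `CMKolyvaginExactAtInertTwo` (stmt-BirchSwinnertonDyer-24277):
# the `Γ_K`-module `E[2]` at `p = 2` — SIMPLE, with SCALAR commutant `𝔽₂` — the `p = 2`
# counterparts of `KolyvaginImage.eq_bot_or_eq_top` / `KolyvaginImage.exists_eq_zsmul`

Seat `bsd-line-cmk2-p1` g3 (cell `bsd-print-cf2`); helper (`--supports stmt-BirchSwinnertonDyer-24277`;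
equally serves route GenusKolyvaginAtTwo's 22137). THEOREMS ONLY: no definition, no named fact,
no `sorry`; no item is closed; BSD is not proved by any of this.

WHY. Gross's §9 / McCallum's §3 (the Čebotarev leaf of the tree's Kolyvagin machine,
`exists_kolyvaginPrime_gt`) use three properties of the `Γ_K`-module `E_p` that the tree derives in
`HeegnerPointsKolyvaginSquares` from «`ρ̄(Γ_K)` contains all squares of `Aut E_p`» — FOR `p` ODD
(`hp2`): `−1 ∈ ρ̄(Γ_K)` (Prop. 9.1), `E_p` simple (Prop. 9.3: *"since `E_p` is a simple
`𝒢`-module"*), scalar commutant (absolute irreducibility: *"`Hom_𝒢(Gal(L_S/L), E_p) ≃ (ℤ/p)^s`"*).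
The companion file `…RestrictionInjectiveAtTwo.lean` (p595478) replaced the first at `p = 2` by the
order-`3` element `z`. This file gives the other two at `p = 2`:

* `eq_bot_or_eq_top_two` — **`E[2]` is a simple `G`-module** as soon as some `z ∈ G` acts without
  non-zero fixed points (`{0, t, zt, z²t} = E[2]`); for `Γ_K`, `K` quadratic, `ρ̄_{E,2}` onto:
  `eq_bot_or_eq_top_two_of_hasSurjectiveModNGaloisRep`.
* `eq_zero_or_eq_id_of_commute_two` — **the commutant is `𝔽₂ = {0, 1}`** as soon as `G` contains
  such a `z` AND an element `τ` with a non-zero fixed point that moves some point (a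
  TRANSPOSITION: for `Γ_K` this is `ρ̄(Γ_K) = S₃`, i.e. `K ≠ ℚ(√Δ_E)` — on the habitat H₂ every
  admissible Heegner field, since `d_K ≠ d_F`; NOT automatic from the squares hypothesis alone:
  with `ρ̄(Γ_K) = C₃` the commutant is `𝔽₄`). An additive `f` commuting with `z` is `0`, `1`, `z`
  or `z²` (it is determined by `f a`); `z^{±1}` do not commute with `τ` (else `τ` would fix
  `z^k u` for its fixed `u ≠ 0`, i.e. everything).

What has NO `p = 2` counterpart is `KolyvaginImage.exists_two_mul_zsmul_eq` (`2 ∈ (ℤ/p)ˣ`) and the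
`±`-eigenvector choice `RatClosure.exists_eigenvectors` — the genuine obstruction of the memo
`Cruxes/CMExactDescentAtTwo/MEMO-tau-line-at-two.md` §1.

References: [GrossLMS1991] §9 Props. 9.1, 9.3; [McCallumLMS1991] §3 Prop. 3.1;
[LawsonWuthrich2016] Lemma 6.
-/

-- single-conjunct summit: `Summit.BirchSwinnertonDyer.BirchSwinnertonDyer.…` repeats the name by design
set_option linter.dupNamespace false
set_option autoImplicit false

noncomputable section

open scoped Classical

namespace Summit.BirchSwinnertonDyer.BirchSwinnertonDyer.Theorems.KolyvaginImageTwo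

open WeierstrassCurve Field
open Literature.NumberTheory.EllipticCurves Literature.NumberTheory.GaloisRepresentations

universe u

section Module

variable {G : Type*} [Group G] {T : Type*} [AddCommGroup T] [DistribMulAction G T]

/-- **`E[2]` is a simple `G`-module** when some `z ∈ G` acts on the `4`-group `T` without non-zero
fixed points: a `G`-stable subgroup `H` is `⊥` or `⊤` (a non-zero `t ∈ H` gives `zt, z²t = t + zt ∈ H`,
and `{0, t, zt, t + zt} = T`). The `p = 2` counterpart of `KolyvaginImage.eq_bot_or_eq_top`.
[cite: GrossLMS1991, §9 (proof of Prop. 9.3)] -/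
theorem eq_bot_or_eq_top_two (h2 : ∀ t : T, t + t = 0) (hcard : Nat.card T = 4) {z : G}
    (hzfix : ∀ t : T, z • t = t → t = 0) (H : AddSubgroup T)
    (hH : ∀ g : G, ∀ t ∈ H, g • t ∈ H) : H = ⊥ ∨ H = ⊤ := by
  by_cases hbot : H = ⊥
  · exact Or.inl hbot
  right
  obtain ⟨t, htH, ht0⟩ : ∃ t ∈ H, t ≠ 0 := by
    by_contra h
    push Not at h
    exact hbot ((AddSubgroup.eq_bot_iff_forall _).mpr h)
  obtain ⟨hzt0, hztt, hzzt⟩ :=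
    apply_apply_eq_add_of_fixedPointFree h2 hcard (DistribMulAction.toAddEquiv T z) hzfix ht0
  change z • t ≠ 0 at hzt0
  change z • t ≠ t at hztt
  have hzt : z • t ∈ H := hH z t htH
  rw [eq_top_iff]
  intro s _
  rcases mem_four h2 hcard ht0 hzt0 hztt s with rfl | rfl | rfl | rfl
  · exact H.zero_mem
  · exact htH
  · exact hzt
  · exact H.add_mem htH hzt

/-- **The commutant of `E[2]` is `𝔽₂`** when `G` contains an element `z` acting without non-zero
fixed points and an element `τ` acting as a TRANSPOSITION (a non-zero fixed point `u`, and some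
point moved): an additive endomorphism `f` commuting with the `G`-action is `0` or the identity.
(`f` commutes with `z`, so `f ∈ {0, 1, z, z²}` — determined by `f a`; `z^{±1}` cannot commute
with `τ`, else `τ` fixes `u, zu, z²u`, i.e. all of `T`.) The `p = 2` counterpart of
`KolyvaginImage.exists_eq_zsmul`. [cite: GrossLMS1991, §9 (proof of Prop. 9.3)] -/
theorem eq_zero_or_eq_id_of_commute_two (h2 : ∀ t : T, t + t = 0) (hcard : Nat.card T = 4)
    {z : G} (hzfix : ∀ t : T, z • t = t → t = 0) {τ : G} {u w : T} (hu : τ • u = u) (hu0 : u ≠ 0)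
    (hw : τ • w ≠ w) (f : T →+ T) (hf : ∀ (g : G) (t : T), f (g • t) = g • f t) :
    (∀ t, f t = 0) ∨ (∀ t, f t = t) := by
  obtain ⟨hzu0, hzuu, hzzu⟩ :=
    apply_apply_eq_add_of_fixedPointFree h2 hcard (DistribMulAction.toAddEquiv T z) hzfix hu0
  change z • u ≠ 0 at hzu0
  change z • u ≠ u at hzuu
  change z • z • u = u + z • u at hzzu
  -- `τ` does not fix `z • u` (else it fixes everything, contradicting `hw`)
  have hτzu : τ • z • u ≠ z • u := by
    intro h
    apply hw
    rcases mem_four h2 hcard hu0 hzu0 hzuu w with rfl | rfl | rfl | rfl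
    · exact smul_zero τ
    · exact hu
    · exact h
    · rw [smul_add, hu, h]
  -- likewise `τ` does not fix `z • z • u = u + z • u`
  have hτzzu : τ • (u + z • u) ≠ u + z • u := by
    intro h
    apply hτzu
    have : τ • z • u = τ • (u + z • u) - τ • u := by rw [smul_add, add_sub_cancel_left]
    rw [this, h, hu, add_sub_cancel_left]
  -- `f` is determined by `f u ∈ {0, u, zu, u + zu}`
  have hfz : f (z • u) = z • f u := hf z u
  have hfzz : f (u + z • u) = f u + z • f u := by rw [map_add, hfz]
  have hfτ : τ • f u = f u := by rw [← hf τ u, hu]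
  rcases mem_four h2 hcard hu0 hzu0 hzuu (f u) with h | h | h | h
  · -- `f u = 0`: `f = 0`
    left
    intro t
    rcases mem_four h2 hcard hu0 hzu0 hzuu t with rfl | rfl | rfl | rfl
    · exact map_zero f
    · exact h
    · rw [hfz, h, smul_zero]
    · rw [hfzz, h, smul_zero, add_zero]
  · -- `f u = u`: `f = id`
    right
    intro t
    rcases mem_four h2 hcard hu0 hzu0 hzuu t with rfl | rfl | rfl | rfl
    · exact map_zero f
    · exact h
    · rw [hfz, h]
    · rw [hfzz, h]
  · -- `f u = z u`: then `τ` fixes `z u` — contradiction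
    exfalso
    rw [h] at hfτ
    exact hτzu hfτ
  · -- `f u = u + z u = z² u`: then `τ` fixes it — contradiction
    exfalso
    rw [h] at hfτ
    exact hτzzu hfτ

end Module

/-! ## Instantiation: `Γ_K` on `E(K̄)[2]`, `K` quadratic, `ρ̄_{E,2}` onto -/

section Galois

/-- **`E(K̄)[2]` is a simple `Γ_K`-module** for `W/ℚ` with `ρ̄_{W,2}` onto and `[K:ℚ] = 2`: every
`Γ_K`-stable subgroup is `⊥` or `⊤` (the order-`3` element of
`KolyvaginImageTwo.exists_smul_three_of_hasSurjectiveModNGaloisRep`). The `p = 2` form of the input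
`hS` of the machine's `IsLiftOfAut.exists_h1Eval_conj_mul_eq_zero_iff`.
[cite: GrossLMS1991, §9 (proof of Prop. 9.3)] -/
theorem eq_bot_or_eq_top_two_of_hasSurjectiveModNGaloisRep (W : WeierstrassCurve ℚ) [W.IsElliptic]
    (K : Type) [Field K] [NumberField K] (hK2 : Module.finrank ℚ K = 2)
    (hsurj : W.HasSurjectiveModNGaloisRep 2)
    (H : AddSubgroup (geomTorsion (W.baseChange K) ((2 : ℕ) : ℤ)))
    (hH : ∀ g : absoluteGaloisGroup K, ∀ t ∈ H, g • t ∈ H) : H = ⊥ ∨ H = ⊤ := by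
  obtain ⟨z, -, hzfix⟩ := exists_smul_three_of_hasSurjectiveModNGaloisRep W K hK2 hsurj
  have h2 : ∀ t : geomTorsion (W.baseChange K) ((2 : ℕ) : ℤ), t + t = 0 := fun t ↦ by
    have := AddSubgroup.torsionBy.nsmul t
    rwa [two_nsmul] at this
  exact eq_bot_or_eq_top_two h2 (natCard_geomTorsion_two W K) hzfix H hH

/-- **The commutant of the `Γ_K`-module `E(K̄)[2]` is `𝔽₂`** for `W/ℚ` with `ρ̄_{W,2}` onto,
`[K:ℚ] = 2`, PROVIDED some `τ ∈ Γ_K` acts as a transposition on `E[2]` (a non-zero fixed point and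
a moved point; i.e. `ρ̄(Γ_K) = S₃`, `K ≠ ℚ(√Δ_E)`): a `Γ_K`-equivariant additive endomorphism is
`0` or `1`. The `p = 2` form of the input `hCe` of the machine's
`IsLiftOfAut.exists_h1Eval_conj_mul_eq_zero_iff` (there `f = e • id` with `e ∈ ℤ/p`).
[cite: GrossLMS1991, §9 (proof of Prop. 9.3)] -/
theorem eq_zero_or_eq_id_of_commute_two_of_hasSurjectiveModNGaloisRep (W : WeierstrassCurve ℚ)
    [W.IsElliptic] (K : Type) [Field K] [NumberField K] (hK2 : Module.finrank ℚ K = 2)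
    (hsurj : W.HasSurjectiveModNGaloisRep 2) {τ : absoluteGaloisGroup K}
    {u w : geomTorsion (W.baseChange K) ((2 : ℕ) : ℤ)} (hu : τ • u = u) (hu0 : u ≠ 0) (hw : τ • w ≠ w)
    (f : geomTorsion (W.baseChange K) ((2 : ℕ) : ℤ) →+ geomTorsion (W.baseChange K) ((2 : ℕ) : ℤ))
    (hf : ∀ (g : absoluteGaloisGroup K) (t : geomTorsion (W.baseChange K) ((2 : ℕ) : ℤ)),
      f (g • t) = g • f t) :
    (∀ t, f t = 0) ∨ (∀ t, f t = t) := by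
  obtain ⟨z, -, hzfix⟩ := exists_smul_three_of_hasSurjectiveModNGaloisRep W K hK2 hsurj
  have h2 : ∀ t : geomTorsion (W.baseChange K) ((2 : ℕ) : ℤ), t + t = 0 := fun t ↦ by
    have := AddSubgroup.torsionBy.nsmul t
    rwa [two_nsmul] at this
  exact eq_zero_or_eq_id_of_commute_two h2 (natCard_geomTorsion_two W K) hzfix hu hu0 hw f hf

end Galois

end Summit.BirchSwinnertonDyer.BirchSwinnertonDyer.Theorems.KolyvaginImageTwo

end
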